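import Summits.QuantumFields.YangMills.Theorems.IR.BlockedActivityWLocChainFactors
import HarnessLib

/-!
# Crux `IR` (stmt-QuantumFields-19354), lane B «strong coupling AFTER BLOCKING»: chain representations, part 3 — chain data of a region, the cell
# σ-algebras, finite range, locality, bounds

Helper module for item `stmt-QuantumFields-19354` (`--supports`; it closes nothing), lane `ym-19354-onsetsc-p2` (g4); part 3 of the chain
construction for Q-loc (parts 1–2: `BlockedActivityWLocChainLaw ∕ …Factors`).  `ChainData ρ β w Y S m`: a chain of `m+2` distinct cells
`c₀ = 0, …, c_{m+1}`, consecutive ones `CellAdj`-adjacent, a reading set `T` of cells adjacent to `c_{m+1}` outside `Y`, weights, centre modes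
`φ_i`, reading modes `ψ_i` (reading the datum on `T` only), a reference datum `τ`, and THE MODE DECOMPOSITION of the centre response of the kernel
of `Y` over `S`: `∫ f dγ_σ = ∫ f dγ_τ + Σ_i t_i^{m+2} ψ_i(σ) ∫ f φ_i dγ_τ`.  Here: the cell σ-algebras (labels of the bonds a cell reads,
`cellSigma`), **finite-range dependence of the label reference** (`indep_cellSigma`: non-touching cell sets read disjoint bond sets — Mathlib
`iIndepFun_pi`, `indep_iSup_of_disjoint`), the cell factors (`cellFac`) with measurability (`measurable_cellFac`) and `local_g`
(`cellFac_local`: only the reading cell reads the datum, on `T`), the product over the perturbed cells (`prod_cellFac`), and the bounds putting the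
realised observable `∫ f dγ_τ + ½ sgn₀ D_{i₀}(f)` in `[0, 1]` (`obsR_mem`, from `|D_i| ≤ 2∫f` and `|D_i| ≤ 2(1 − ∫f)`).  Part 4 is the representation.

HONEST FRAMING: format bookkeeping about the lane's own currency; nothing about weak coupling, a gap or Clay.
No `sorry`; axioms ⊆ {propext, Classical.choice, Quot.sound}; no instances, no notation.
Refs: KoteckyPreiss1986; FriedliVelenik2017 §5.7.1; BauerschmidtBrydgesSlade2019 §3.3.
-/


set_option autoImplicit false

noncomputable section

open MeasureTheory ProbabilityTheory Finset
open scoped ENNReal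
open Literature.MathematicalPhysics.QuantumFieldTheory Literature.MathematicalPhysics.QuantumLattice
open Literature.Probability.LatticeModels (IsLocalPerturbation IsLocalObservable pertExpect pertNum pertZ Touches)
open Summit.QuantumFields.YangMills.Cruxes.IR.Tempered (cellEdges windowCells regionEdges)

namespace Summit.QuantumFields.YangMills.Cruxes.IR.BlockedActivity

/-! ## §4 The chain data of a region and the representation -/

section Rep

open Chain

variable {G : Type} [Group G] [TopologicalSpace G] [IsTopologicalGroup G] [CompactSpace G]
  [MeasurableSpace G] [BorelSpace G] {N : ℕ} {ρ : G →* Matrix (Fin N) (Fin N) ℂ} {β : ℝ}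
  {w : Fin 4 → ℤ → ℤ} {Y : Finset Cell} {S : Set (LGConfig 4 G)} {m : ℕ}

/-- **Chain data for the region `Y` over the data `S`**: a chain of `m+2` distinct cells `c₀ = 0, …, c_{m+1}` with consecutive cells adjacent,
a reading set `T` of cells adjacent to `c_{m+1}` outside `Y`, weights `W`, centre modes `φ_i` (`|φ_i| ≤ 1`, measurable), reading modes `ψ_i`
(`|ψ_i| ≤ 1`, reading the datum on `T` only), a reference datum `τ`, and THE MODE DECOMPOSITION of the centre response of the kernel of `Y`:
`∫ f dγ_σ = ∫ f dγ_τ + Σ_i t_i^{m+2} ψ_i(σ) ∫ f φ_i dγ_τ` for every `σ ∈ S` and every centre observable `f`. -/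
structure ChainData (ρ : G →* Matrix (Fin N) (Fin N) ℂ) (β : ℝ) (w : Fin 4 → ℤ → ℤ) (Y : Finset Cell)
    (S : Set (LGConfig 4 G)) (m : ℕ) where
  /-- the cells of the chain -/
  c : Fin (m + 2) → Cell
  /-- it starts at the centre -/
  c_zero : c 0 = 0
  /-- consecutive cells are adjacent -/
  adj : ∀ k : Fin (m + 1), CellAdj (c k.castSucc) (c k.succ)
  /-- the cells are distinct -/
  inj : Function.Injective c
  /-- the reading set -/
  T : Finset Cell
  /-- its cells are adjacent to the reading cell -/
  T_adj : ∀ q ∈ T, CellAdj q (c (Fin.last (m + 1)))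
  /-- and lie outside the region -/
  T_out : ∀ q ∈ T, q ∉ Y
  /-- the weights -/
  W : Weights
  /-- the centre modes -/
  φ : ℕ → LGConfig 4 G → ℝ
  /-- measurable -/
  φ_meas : ∀ i, Measurable (φ i)
  /-- bounded by `1` -/
  φ_bdd : ∀ i U, |φ i U| ≤ 1
  /-- the reading modes -/
  ψ : ℕ → LGConfig 4 G → ℝ
  /-- bounded by `1` -/
  ψ_bdd : ∀ i σ, |ψ i σ| ≤ 1
  /-- they read the datum on the cells of `T` only -/
  ψ_loc : ∀ i, ∀ σ σ' : LGConfig 4 G, (∀ q ∈ T, ∀ e ∈ cellEdges w q, σ e = σ' e) → ψ i σ = ψ i σ'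
  /-- the reference datum -/
  τ : LGConfig 4 G
  /-- THE MODE DECOMPOSITION of the centre response over `S` -/
  rep : ∀ σ ∈ S, ∀ f : LGConfig 4 G → ℝ, IsCentreObs w f →
    ∫ U, f U ∂(ymSpecification ρ β (regionEdges w Y) σ) =
      ∫ U, f U ∂(ymSpecification ρ β (regionEdges w Y) τ) +
        ∑' i, W.t i ^ (m + 2) * ψ i σ * ∫ U, f U * φ i U ∂(ymSpecification ρ β (regionEdges w Y) τ)

namespace ChainData

variable (X : ChainData ρ β w Y S m)

/-- The reference kernel `γ_τ`. -/
abbrev γτ : Measure (LGConfig 4 G) := ymSpecification ρ β (regionEdges w Y) X.τ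

/-- The bonds read by a cell: bond `j` joins `c_j` and `c_{j+1}`. -/
def verts (p : Cell) : Finset (Fin (m + 1)) := univ.filter fun j => p = X.c j.castSucc ∨ p = X.c j.succ

/-- The cell σ-algebras: generated by the labels of the bonds the cell reads (trivial off the chain). -/
@[reducible] def cellSigma (p : Cell) : MeasurableSpace (BondCfg m) :=
  ⨆ j ∈ X.verts p, (inferInstance : MeasurableSpace Label).comap fun b : BondCfg m => b j

/-- The coordinate of a bond read by `p` is measurable for the cell σ-algebra of `p`. -/
theorem measurable_eval {p : Cell} {j : Fin (m + 1)} (hj : j ∈ X.verts p) : Measurable[X.cellSigma p] fun b : BondCfg m => b j :=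
  measurable_iff_comap_le.2
    (le_iSup₂ (f := fun j (_ : j ∈ X.verts p) => (inferInstance : MeasurableSpace Label).comap fun b : BondCfg m => b j) j hj)

/-- Position `k` reads bond `k`. -/
theorem mem_verts_self (k : Fin (m + 1)) : k ∈ X.verts (X.c k.succ) :=
  mem_filter.2 ⟨mem_univ _, Or.inr rfl⟩

/-- Position `k` reads bond `k+1`. -/
theorem mem_verts_next (k : Fin (m + 1)) (h : k.val + 1 < m + 1) : (⟨k.val + 1, h⟩ : Fin (m + 1)) ∈ X.verts (X.c k.succ) :=
  mem_filter.2 ⟨mem_univ _, Or.inl (congrArg X.c (Fin.ext (by simp)))⟩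

/-- The centre reads bond `0`. -/
theorem zero_mem_verts_zero : (0 : Fin (m + 1)) ∈ X.verts 0 :=
  mem_filter.2 ⟨mem_univ _, Or.inl (by rw [Fin.castSucc_zero', X.c_zero])⟩

/-- The cell factors: the factor of position `k` at the cell `c_{k+1}`, zero off the perturbed cells. -/
def cellFac (σ : LGConfig 4 G) (p : Cell) (b : BondCfg m) : ℂ :=
  if h : ∃ k : Fin (m + 1), X.c k.succ = p then ((X.W.fac (fun i => X.ψ i σ) (Classical.choose h) b : ℝ) : ℂ) else 0

/-- The factor at a perturbed cell. -/
theorem cellFac_pos (σ : LGConfig 4 G) (k : Fin (m + 1)) :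
    X.cellFac σ (X.c k.succ) = fun b => ((X.W.fac (fun i => X.ψ i σ) k b : ℝ) : ℂ) := by
  have h : ∃ k' : Fin (m + 1), X.c k'.succ = X.c k.succ := ⟨k, rfl⟩
  have hk : Classical.choose h = k := Fin.succ_injective _ (X.inj (Classical.choose_spec h))
  funext b
  unfold cellFac
  rw [dif_pos h, hk]

/-- The perturbed cells `c₁, …, c_{m+1}`. -/
def C : Finset Cell := univ.image fun k : Fin (m + 1) => X.c k.succ

/-- The realised observable. -/
def obs (f : LGConfig 4 G → ℝ) (b : BondCfg m) : ℂ :=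
  ((obsR (∫ U, f U ∂X.γτ) (fun i => ∫ U, f U * (X.φ i U - ∫ V, X.φ i V ∂X.γτ) ∂X.γτ) b : ℝ) : ℂ)

/-- **Finite-range dependence of the label reference**: non-touching cell sets read disjoint sets of bonds. -/
theorem indep_cellSigma (K₁ K₂ : Finset Cell) (hK : ¬ Touches CellAdj K₁ K₂) :
    Indep (⨆ p ∈ K₁, X.cellSigma p) (⨆ p ∈ K₂, X.cellSigma p) (X.W.chainLaw m) := by
  classical
  haveI := X.W.isProbabilityMeasure_labelLaw
  have h1 : (⨆ p ∈ K₁, X.cellSigma p) =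
      ⨆ j ∈ K₁.biUnion X.verts, (inferInstance : MeasurableSpace Label).comap fun b : BondCfg m => b j := by
    unfold cellSigma; rw [Finset.iSup_biUnion]
  have h2 : (⨆ p ∈ K₂, X.cellSigma p) =
      ⨆ j ∈ K₂.biUnion X.verts, (inferInstance : MeasurableSpace Label).comap fun b : BondCfg m => b j := by
    unfold cellSigma; rw [Finset.iSup_biUnion]
  rw [h1, h2]
  have hind : iIndep (fun j : Fin (m + 1) => (inferInstance : MeasurableSpace Label).comap fun b : BondCfg m => b j)
      (X.W.chainLaw m) :=
    (iIndepFun_pi (μ := fun _ : Fin (m + 1) => X.W.labelLaw) (X := fun _ => (id : Label → Label))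
      fun _ => aemeasurable_id).iIndep
  have hdisj : Disjoint (K₁.biUnion X.verts) (K₂.biUnion X.verts) := by
    rw [Finset.disjoint_left]
    intro j hj1 hj2
    obtain ⟨p, hp, hjp⟩ := mem_biUnion.1 hj1
    obtain ⟨q, hq, hjq⟩ := mem_biUnion.1 hj2
    have hp' := (mem_filter.1 hjp).2
    have hq' := (mem_filter.1 hjq).2
    have hadj := X.adj j
    have hsymm : CellAdj (X.c j.succ) (X.c j.castSucc) := fun i => by rw [abs_sub_comm]; exact hadj i
    refine hK ⟨p, hp, q, hq, ?_⟩
    rcases hp' with hp' | hp' <;> rcases hq' with hq' | hq' <;> subst hp' <;> subst hq'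
    · exact Or.inl rfl
    · exact Or.inr hadj
    · exact Or.inr hsymm
    · exact Or.inl rfl
  exact indep_iSup_of_disjoint (S := (K₁.biUnion X.verts : Set (Fin (m + 1)))) (T := (K₂.biUnion X.verts : Set (Fin (m + 1))))
    (fun j => (measurable_pi_apply j).comap_le) hind (Finset.disjoint_coe.2 hdisj)

/-- The cell factors are measurable for their cell σ-algebras. -/
theorem measurable_cellFac (σ : LGConfig 4 G) (p : Cell) : Measurable[X.cellSigma p] (X.cellFac σ p) := by
  by_cases h : ∃ k : Fin (m + 1), X.c k.succ = p
  · obtain ⟨k, rfl⟩ := h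
    rw [cellFac_pos]
    by_cases hk : k.val + 1 < m + 1
    · have hfun : (fun b : BondCfg m => ((X.W.fac (fun i => X.ψ i σ) k b : ℝ) : ℂ)) =
          (fun l : Label × Label => ((X.W.Z * (if l.1.1 = l.2.1 then 1 else 0) * sgn l.1 * sgn l.2 : ℝ) : ℂ)) ∘
            fun b : BondCfg m => (b k, b ⟨k.val + 1, hk⟩) := by
        funext b; simp only [Function.comp, Weights.fac, dif_pos hk]
      rw [hfun]
      exact (measurable_of_countable _).comp ((X.measurable_eval (X.mem_verts_self k)).prodMk
        (X.measurable_eval (X.mem_verts_next k hk)))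
    · have hfun : (fun b : BondCfg m => ((X.W.fac (fun i => X.ψ i σ) k b : ℝ) : ℂ)) =
          (fun l : Label => ((2 * X.W.Z * X.W.t l.1 * X.ψ l.1 σ * sgn l : ℝ) : ℂ)) ∘ fun b : BondCfg m => b k := by
        funext b; simp only [Function.comp, Weights.fac, dif_neg hk]
      rw [hfun]
      exact (measurable_of_countable _).comp (X.measurable_eval (X.mem_verts_self k))
  · have hfun : X.cellFac σ p = fun _ => 0 := by funext b; unfold cellFac; rw [dif_neg h]
    rw [hfun]; exact measurable_const

/-- The cell factors read the datum only on the cells adjacent to their cell outside `Y` (only the reading cell reads it, on `T`). -/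
theorem cellFac_local (p : Cell) (σ σ' : LGConfig 4 G)
    (h : ∀ q, CellAdj q p → q ∉ Y → ∀ e ∈ cellEdges w q, σ e = σ' e) : X.cellFac σ p = X.cellFac σ' p := by
  by_cases hp : ∃ k : Fin (m + 1), X.c k.succ = p
  · obtain ⟨k, rfl⟩ := hp
    rw [cellFac_pos, cellFac_pos]
    funext b
    by_cases hk : k.val + 1 < m + 1
    · simp only [Weights.fac, dif_pos hk]
    · have hlast : k = Fin.last m := by
        refine Fin.ext (le_antisymm (Nat.lt_succ_iff.1 k.isLt) ?_)
        simp at hk ⊢; omega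
      have hψ : ∀ i, X.ψ i σ = X.ψ i σ' := fun i =>
        X.ψ_loc i σ σ' fun q hq => h q (by rw [hlast, Fin.succ_last]; exact X.T_adj q hq) (X.T_out q hq)
      simp only [Weights.fac, dif_neg hk, hψ]
  · funext b; unfold cellFac; rw [dif_neg hp, dif_neg hp]

/-- The product of `1 +` cell factors over the perturbed cells is the product of `1 +` position factors. -/
theorem prod_cellFac (σ : LGConfig 4 G) (b : BondCfg m) :
    ∏ p ∈ X.C, (1 + X.cellFac σ p b) = ((∏ k, (1 + X.W.fac (fun i => X.ψ i σ) k b) : ℝ) : ℂ) := by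
  unfold C
  rw [prod_image fun k _ k' _ hkk' => Fin.succ_injective _ (X.inj hkk')]
  push_cast
  exact prod_congr rfl fun k _ => by rw [cellFac_pos]

/-! ### Bounds for the realised observable -/

section ObsBounds

variable [SecondCountableTopology G] (hρ : Continuous ρ) {f : LGConfig 4 G → ℝ} (hf : IsCentreObs w f)
include hρ hf

/-- `0 ≤ ∫ f dγ_τ ≤ 1`. -/
theorem integral_centreObs_mem :
    0 ≤ ∫ U, f U ∂X.γτ ∧ ∫ U, f U ∂X.γτ ≤ 1 := by
  haveI := isProbabilityMeasure_ymSpecification ρ hρ β (regionEdges w Y) X.τ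
  refine ⟨integral_nonneg fun U => (hf.2.2 U).1, ?_⟩
  calc ∫ U, f U ∂X.γτ ≤ ∫ _U, (1 : ℝ) ∂X.γτ :=
        integral_mono_of_nonneg (ae_of_all _ fun U => (hf.2.2 U).1) (integrable_const _) (ae_of_all _ fun U => (hf.2.2 U).2)
    _ = 1 := by simp

/-- The centred mode integral `D_i = ∫ f (φ_i − ∫φ_i)` satisfies `|D_i| ≤ 2 ∫ f` and `|D_i| ≤ 2 (1 − ∫ f)`. -/
theorem abs_modeIntegral_le (i : ℕ) :
    |∫ U, f U * (X.φ i U - ∫ V, X.φ i V ∂X.γτ) ∂X.γτ| ≤ 2 * ∫ U, f U ∂X.γτ ∧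
      |∫ U, f U * (X.φ i U - ∫ V, X.φ i V ∂X.γτ) ∂X.γτ| ≤ 2 * (1 - ∫ U, f U ∂X.γτ) := by
  haveI := isProbabilityMeasure_ymSpecification ρ hρ β (regionEdges w Y) X.τ
  set mi : ℝ := ∫ V, X.φ i V ∂X.γτ with hmi
  have hmi1 : |mi| ≤ 1 := by
    rw [hmi]
    calc |∫ V, X.φ i V ∂X.γτ| ≤ ∫ V, |X.φ i V| ∂X.γτ := abs_integral_le_integral_abs
      _ ≤ ∫ _V, (1 : ℝ) ∂X.γτ := integral_mono_of_nonneg (ae_of_all _ fun V => abs_nonneg _) (integrable_const _)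
          (ae_of_all _ fun V => X.φ_bdd i V)
      _ = 1 := by simp
  have hφc : ∀ U, |X.φ i U - mi| ≤ 2 := fun U => by
    calc |X.φ i U - mi| ≤ |X.φ i U| + |mi| := abs_sub _ _
      _ ≤ 1 + 1 := add_le_add (X.φ_bdd i U) hmi1
      _ = 2 := by norm_num
  have hfm : Measurable f := hf.2.1
  have hφm : Measurable fun U => X.φ i U - mi := (X.φ_meas i).sub measurable_const
  have hfi : Integrable f X.γτ := Integrable.of_bound hfm.aestronglyMeasurable 1
    (ae_of_all _ fun U => by rw [Real.norm_eq_abs, abs_of_nonneg (hf.2.2 U).1]; exact (hf.2.2 U).2)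
  have hprod_int : Integrable (fun U => f U * (X.φ i U - mi)) X.γτ := Integrable.of_bound (hfm.mul hφm).aestronglyMeasurable 2
    (ae_of_all _ fun U => by
      rw [Real.norm_eq_abs, abs_mul, abs_of_nonneg (hf.2.2 U).1]
      calc f U * |X.φ i U - mi| ≤ 1 * 2 := mul_le_mul (hf.2.2 U).2 (hφc U) (abs_nonneg _) zero_le_one
        _ = 2 := one_mul _)
  have hprod_int' : Integrable (fun U => (1 - f U) * (X.φ i U - mi)) X.γτ :=
    Integrable.of_bound ((measurable_const.sub hfm).mul hφm).aestronglyMeasurable 2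
      (ae_of_all _ fun U => by
        rw [Real.norm_eq_abs, abs_mul, abs_of_nonneg (by linarith [(hf.2.2 U).2] : (0 : ℝ) ≤ 1 - f U)]
        calc (1 - f U) * |X.φ i U - mi| ≤ 1 * 2 := mul_le_mul (by linarith [(hf.2.2 U).1]) (hφc U) (abs_nonneg _) zero_le_one
          _ = 2 := one_mul _)
  constructor
  · calc |∫ U, f U * (X.φ i U - mi) ∂X.γτ| ≤ ∫ U, |f U * (X.φ i U - mi)| ∂X.γτ := abs_integral_le_integral_abs
      _ ≤ ∫ U, 2 * f U ∂X.γτ := integral_mono_of_nonneg (ae_of_all _ fun U => abs_nonneg _) (hfi.const_mul 2)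
          (ae_of_all _ fun U => by
            show |f U * (X.φ i U - mi)| ≤ 2 * f U
            rw [abs_mul, abs_of_nonneg (hf.2.2 U).1, mul_comm]
            exact mul_le_mul_of_nonneg_right (hφc U) (hf.2.2 U).1)
      _ = 2 * ∫ U, f U ∂X.γτ := integral_const_mul _ _
  · -- `∫ (φ_i − m_i) = 0`, so `∫ f (φ_i − m_i) = −∫ (1 − f)(φ_i − m_i)`
    have hzero : ∫ U, (X.φ i U - mi) ∂X.γτ = 0 := by
      rw [integral_sub (Integrable.of_bound (X.φ_meas i).aestronglyMeasurable 1
        (ae_of_all _ fun U => by rw [Real.norm_eq_abs]; exact X.φ_bdd i U)) (integrable_const _), integral_const]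
      simp [hmi]
    have heq : ∫ U, f U * (X.φ i U - mi) ∂X.γτ = -∫ U, (1 - f U) * (X.φ i U - mi) ∂X.γτ := by
      have : ∀ U, f U * (X.φ i U - mi) = (X.φ i U - mi) - (1 - f U) * (X.φ i U - mi) := fun U => by ring
      simp_rw [this]
      rw [integral_sub (Integrable.of_bound hφm.aestronglyMeasurable 2
        (ae_of_all _ fun U => by rw [Real.norm_eq_abs]; exact hφc U)) hprod_int', hzero, zero_sub]
    rw [heq, abs_neg]
    calc |∫ U, (1 - f U) * (X.φ i U - mi) ∂X.γτ| ≤ ∫ U, |(1 - f U) * (X.φ i U - mi)| ∂X.γτ := abs_integral_le_integral_abs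
      _ ≤ ∫ U, 2 * (1 - f U) ∂X.γτ := integral_mono_of_nonneg (ae_of_all _ fun U => abs_nonneg _)
          (((integrable_const _).sub hfi).const_mul 2)
          (ae_of_all _ fun U => by
            show |(1 - f U) * (X.φ i U - mi)| ≤ 2 * (1 - f U)
            have h1 : (0 : ℝ) ≤ 1 - f U := by linarith [(hf.2.2 U).2]
            rw [abs_mul, abs_of_nonneg h1, mul_comm]
            exact mul_le_mul_of_nonneg_right (hφc U) h1)
      _ = 2 * (1 - ∫ U, f U ∂X.γτ) := by
          rw [integral_const_mul, integral_sub (integrable_const _) hfi, integral_const]; simp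

/-- The realised observable takes values in `[0, 1]`. -/
theorem obsR_mem (b : BondCfg m) :
    0 ≤ obsR (∫ U, f U ∂X.γτ) (fun i => ∫ U, f U * (X.φ i U - ∫ V, X.φ i V ∂X.γτ) ∂X.γτ) b ∧
      obsR (∫ U, f U ∂X.γτ) (fun i => ∫ U, f U * (X.φ i U - ∫ V, X.φ i V ∂X.γτ) ∂X.γτ) b ≤ 1 := by
  obtain ⟨hA0, hA1⟩ := X.integral_centreObs_mem hρ hf
  obtain ⟨hD1, hD2⟩ := X.abs_modeIntegral_le hρ hf (b 0).1
  unfold obsR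
  have hs : |sgn (b 0)| = 1 := abs_sgn _
  set D := ∫ U, f U * (X.φ (b 0).1 U - ∫ V, X.φ (b 0).1 V ∂X.γτ) ∂X.γτ
  set A := ∫ U, f U ∂X.γτ
  have hsd : |sgn (b 0) * D| = |D| := by rw [abs_mul, hs, one_mul]
  have h1 : sgn (b 0) * D ≤ 2 * (1 - A) := (le_abs_self _).trans (hsd ▸ hD2)
  have h2 : -(2 * A) ≤ sgn (b 0) * D := by
    have := neg_abs_le (sgn (b 0) * D); rw [hsd] at this; linarith
  constructor <;> nlinarith

end ObsBounds

end ChainData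

end Rep

end Summit.QuantumFields.YangMills.Cruxes.IR.BlockedActivity

end
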